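import Summits.MatrixMultiplication.MatrixMultiplication.Theorems.OutsiderSandwichBorderTable
import HarnessLib

/-!
# Laws of the amortised border table and the level-two window

Route `OutsiderSandwich` (decomposition cell `decomp-mm`, lens 4, gen 29), support for the aside
leaf `BlockOneIsMM` (stmt-MatrixMultiplication-27147).  Continues `OutsiderSandwichBorderTable`:

* `amortisedDeg_mul` — levels multiply (Kronecker products of degenerations, BCS (15.25)):
  `a̲(N + N', m m') ≤ a̲(N, m) a̲(N', m')`, `a̲(N, m + m') ≤ a̲(N, m) + a̲(N, m')`,
  `a̲(N, 1) = r̲(N)` (the border door of `OutsiderSandwichBorderExchange`), `a̲(N, m) ≤ m r̲(N)`;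
* **the level-two window**: `⌈8m/7⌉ ≤ a̲(2, m) ≤ 2m` (`border_level_two_floor`; `r̲(2) = 2`),
  `a̲(2, 1) = 2`, `3 ≤ a̲(2, 2) ≤ 5`, `8 ≤ a̲(2, 7) ≤ 14`, and rung `1` of the ladder is the equality
  `a̲(2, 7) = 8` (`borderSaturated_one_iff`);
* record thresholds: `a̲(2, 2) = 3` would give `θ⋆ ≤ log₂(3/2)/2 ≈ 0.2925` and `a̲(2, 7) ≤ 11` would
  give `θ⋆ ≤ log₂(11/7)/2 ≈ 0.326`, both below the standing `0.37295`
  (`exchangeExponent_le_of_two_three_two`, `exchangeExponent_le_of_two_eleven_seven`).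

## References
* P. Bürgisser, M. Clausen, M. A. Shokrollahi, *Algebraic Complexity Theory*, Springer 1997,
  (15.19)–(15.26), Prop. (15.25). [BurgisserClausenShokrollahi1997]
* D. Coppersmith, S. Winograd, *Matrix multiplication via arithmetic progressions*,
  J. Symbolic Comput. 9 (1990) 251–280, §7. [CoppersmithWinograd1990]
* V. Strassen, *The asymptotic spectrum of tensors*, J. reine angew. Math. 384 (1988)
  102–152, Thm. 3.8. [Strassen1988]
-/

noncomputable section

open scoped BigOperators

set_option linter.dupNamespace false
set_option autoImplicit false

namespace Summit.MatrixMultiplication.MatrixMultiplication.Theorems.OutsiderSandwichBorderTableLaws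

open Literature.Computability.AlgebraicComplexity
open Summit.MatrixMultiplication.MatrixMultiplication.Theorems.OutsiderSandwichCoupling (coupling₁)
open Summit.MatrixMultiplication.MatrixMultiplication.Theorems.OutsiderSandwichAmortised
  (mk_unit_kronecker_pow)
open Summit.MatrixMultiplication.MatrixMultiplication.Theorems.OutsiderSandwichBorderExchange
  (restrictsTo_of_mk_eq HelpedDeg borderExchangeNumber helpedDeg_iff_borderExchangeNumber_le
    borderExchangeNumber_two helpedDeg_borderExchangeNumber)
open Summit.MatrixMultiplication.MatrixMultiplication.Theorems.OutsiderSandwichExchangeExponent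
  (exchangeExponent)
open Summit.MatrixMultiplication.MatrixMultiplication.Theorems.OutsiderSandwichAmortisedTable
  (amortisedNumber)
open Summit.MatrixMultiplication.MatrixMultiplication.Theorems.OutsiderSandwichAmortisedLaws
  (amortisedNumber_two_two_mem)
open Summit.MatrixMultiplication.MatrixMultiplication.Theorems.OutsiderSandwichBorderFloor
  (border_level_two_floor)
open Summit.MatrixMultiplication.MatrixMultiplication.Theorems.OutsiderSandwichBorderTable
  (AmortisedDeg borderAmortisedNumber amortisedDeg_borderAmortisedNumber borderAmortisedNumber_le
    amortisedDeg_iff_le amortisedDeg_one_iff borderAmortisedNumber_le_amortisedNumber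
    BorderSaturated exchangeExponent_le_of_amortisedDeg)

/-! ## 1. Levels multiply -/

/-- `[⟨B⟩ ⊠ t^{⊠N} ⊠ ⟨B'⟩ ⊠ t^{⊠N'}] = [⟨B B'⟩ ⊠ t^{⊠(N+N')}]` in `T(ℂ)`. [cite: Zuiddam2018, §2.3] -/
theorem mk_kronecker_unit_kronecker {ι κ μ : Type} [Fintype ι] [Fintype κ] [Fintype μ]
    [DecidableEq ι] [DecidableEq κ] [DecidableEq μ] (t : ι → κ → μ → ℂ) (N N' B B' : ℕ) :
    TensorClass.mk (kroneckerTensor (kroneckerTensor (unitTensor ℂ B) (kroneckerPow t N))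
        (kroneckerTensor (unitTensor ℂ B') (kroneckerPow t N'))) =
      TensorClass.mk (kroneckerTensor (unitTensor ℂ (B * B')) (kroneckerPow t (N + N'))) := by
  rw [← TensorClass.mk_mul_mk, mk_unit_kronecker_pow, mk_unit_kronecker_pow,
    mk_unit_kronecker_pow]
  push_cast
  ring

/-- **Levels multiply**: `AmortisedDeg N B m → AmortisedDeg N' B' m' → AmortisedDeg (N+N') (BB') (mm')`
(Kronecker products of degenerations). [cite: BurgisserClausenShokrollahi1997, Prop. (15.25)] -/
theorem amortisedDeg_mul {N N' B B' m m' : ℕ} (h : AmortisedDeg N B m) (h' : AmortisedDeg N' B' m') :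
    AmortisedDeg (N + N') (B * B') (m * m') :=
  ((restrictsTo_of_mk_eq (mk_kronecker_unit_kronecker coupling₁ N N' B B')).algDegeneratesTo_trans
    (AlgDegeneratesTo.kronecker h h')).trans_restrictsTo
    (restrictsTo_of_mk_eq (mk_kronecker_unit_kronecker (matMulTensor ℂ 2 2 2) N N' m m').symm)

/-- **`a̲(N + N', m m') ≤ a̲(N, m) · a̲(N', m')`.** [cite: BurgisserClausenShokrollahi1997, Prop. (15.25)] -/
theorem borderAmortisedNumber_mul_le (N N' m m' : ℕ) :
    borderAmortisedNumber (N + N') (m * m') ≤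
      borderAmortisedNumber N m * borderAmortisedNumber N' m' :=
  borderAmortisedNumber_le
    (amortisedDeg_mul (amortisedDeg_borderAmortisedNumber N m) (amortisedDeg_borderAmortisedNumber N' m'))

/-- **`a̲(N, m + m') ≤ a̲(N, m) + a̲(N, m')`.** [cite: BurgisserClausenShokrollahi1997, Prop. (15.25)] -/
theorem borderAmortisedNumber_add_le (N m m' : ℕ) :
    borderAmortisedNumber N (m + m') ≤ borderAmortisedNumber N m + borderAmortisedNumber N m' :=
  borderAmortisedNumber_le
    ((amortisedDeg_borderAmortisedNumber N m).add (amortisedDeg_borderAmortisedNumber N m'))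

/-- **`a̲(N, 1) = r̲(N)`**: one product is the border door. [cite: CoppersmithWinograd1990, §7] -/
theorem borderAmortisedNumber_one_right (N : ℕ) :
    borderAmortisedNumber N 1 = borderExchangeNumber N := by
  refine le_antisymm ?_ ?_
  · exact borderAmortisedNumber_le ((amortisedDeg_one_iff N _).2 (helpedDeg_borderExchangeNumber N))
  · exact helpedDeg_iff_borderExchangeNumber_le.1
      ((amortisedDeg_one_iff N _).1 (amortisedDeg_borderAmortisedNumber N 1))

/-- `a̲(N, k m) ≤ k · a̲(N, m)`. [cite: BurgisserClausenShokrollahi1997, Prop. (15.25)] -/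
theorem borderAmortisedNumber_smul_le (N k m : ℕ) :
    borderAmortisedNumber N (k * m) ≤ k * borderAmortisedNumber N m :=
  borderAmortisedNumber_le ((amortisedDeg_borderAmortisedNumber N m).smul k)

/-- **`a̲(N, m) ≤ m · r̲(N)`.** [cite: CoppersmithWinograd1990, §7] -/
theorem borderAmortisedNumber_le_mul_borderExchangeNumber (N m : ℕ) :
    borderAmortisedNumber N m ≤ m * borderExchangeNumber N := by
  have h := borderAmortisedNumber_smul_le N m 1
  rwa [mul_one, borderAmortisedNumber_one_right] at h

/-! ## 2. The level-two window -/

/-- **Level-two floor `⌈8m/7⌉ ≤ a̲(2, m)`** (coupled-slice floor, border-closed).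
[cite: CoppersmithWinograd1990, §7] -/
theorem ceil_le_borderAmortisedNumber_two (m : ℕ) : (8 * m + 6) / 7 ≤ borderAmortisedNumber 2 m := by
  have := border_level_two_floor (amortisedDeg_borderAmortisedNumber 2 m)
  omega

/-- **`a̲(2, m) ≤ 2m`** (`r̲(2) = 2`: two coupled blocks per `4 × 4` product). [cite: CoppersmithWinograd1990, §7] -/
theorem borderAmortisedNumber_two_le (m : ℕ) : borderAmortisedNumber 2 m ≤ 2 * m := by
  have h := borderAmortisedNumber_le_mul_borderExchangeNumber 2 m
  rw [borderExchangeNumber_two] at h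
  omega

/-- `a̲(2, 1) = 2`. [cite: CoppersmithWinograd1990, §7] -/
theorem borderAmortisedNumber_two_one : borderAmortisedNumber 2 1 = 2 := by
  rw [borderAmortisedNumber_one_right, borderExchangeNumber_two]

/-- **`3 ≤ a̲(2, 2) ≤ 5`** (floor `⌈16/7⌉ = 3`; `a̲ ≤ a(2,2) ≤ 5`); the value `3` would be a `θ⋆` record.
[cite: CoppersmithWinograd1990, §7] -/
theorem borderAmortisedNumber_two_two_mem :
    3 ≤ borderAmortisedNumber 2 2 ∧ borderAmortisedNumber 2 2 ≤ 5 := by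
  refine ⟨ceil_le_borderAmortisedNumber_two 2, ?_⟩
  exact (borderAmortisedNumber_le_amortisedNumber 2 2).trans amortisedNumber_two_two_mem.2

/-- **`8 ≤ a̲(2, 7) ≤ 14`**: the window of rung `1` of the ladder. [cite: CoppersmithWinograd1990, §7] -/
theorem borderAmortisedNumber_two_seven_mem :
    8 ≤ borderAmortisedNumber 2 7 ∧ borderAmortisedNumber 2 7 ≤ 14 :=
  ⟨ceil_le_borderAmortisedNumber_two 7, borderAmortisedNumber_two_le 7⟩

/-- **Rung `1` is the equality `a̲(2, 7) = 8`**: `⟨8⟩ ⊠ C₁^{⊠2} ⊵_deg ⟨7⟩ ⊠ ⟨2,2,2⟩^{⊠2}`. [new] -/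
theorem borderSaturated_one_iff : BorderSaturated 1 ↔ borderAmortisedNumber 2 7 = 8 := by
  have h8 := ceil_le_borderAmortisedNumber_two 7
  change AmortisedDeg 2 8 7 ↔ _
  rw [amortisedDeg_iff_le]
  omega

/-- Rung `n` in table form: `BorderSaturated n ↔ a̲(n+1, 2^{n+2} − 1) ≤ 2^{n+2}`. [new] -/
theorem borderSaturated_iff_le (n : ℕ) :
    BorderSaturated n ↔ borderAmortisedNumber (n + 1) (2 ^ (n + 2) - 1) ≤ 2 ^ (n + 2) :=
  amortisedDeg_iff_le

/-! ## 3. Record thresholds at level two -/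

/-- `a̲(2, 2) = 3`, i.e. `⟨3⟩ ⊠ C₁^{⊠2} ⊵_deg ⟨2⟩ ⊠ ⟨4,4,4⟩`, would give `θ⋆ ≤ log₂(3/2)/2 ≈ 0.2925 <
0.37295`. [cite: Strassen1988, Thm. 3.8] -/
theorem exchangeExponent_le_of_two_three_two (h : AmortisedDeg 2 3 2) :
    exchangeExponent ≤ Real.logb 2 (3 / 2) / 2 := by
  have := exchangeExponent_le_of_amortisedDeg two_pos two_pos h
  norm_num at this
  exact this

/-- `a̲(2, 7) ≤ 11`, i.e. `⟨11⟩ ⊠ C₁^{⊠2} ⊵_deg ⟨7⟩ ⊠ ⟨4,4,4⟩`, would give `θ⋆ ≤ log₂(11/7)/2 ≈ 0.326 <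
0.37295`. [cite: Strassen1988, Thm. 3.8] -/
theorem exchangeExponent_le_of_two_eleven_seven (h : AmortisedDeg 2 11 7) :
    exchangeExponent ≤ Real.logb 2 (11 / 7) / 2 := by
  have := exchangeExponent_le_of_amortisedDeg two_pos (by norm_num : 0 < 7) h
  norm_num at this
  exact this

/-- Rung `1` itself would give `θ⋆ ≤ log₂(8/7)/2 ≈ 0.0963`. [cite: Strassen1988, Thm. 3.8] -/
theorem exchangeExponent_le_of_borderSaturated_one (h : BorderSaturated 1) :
    exchangeExponent ≤ Real.logb 2 (8 / 7) / 2 := by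
  have := exchangeExponent_le_of_amortisedDeg two_pos (by norm_num : 0 < 7) h
  norm_num at this
  exact this

end Summit.MatrixMultiplication.MatrixMultiplication.Theorems.OutsiderSandwichBorderTableLaws
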